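import Summits.KontsevichZagierPeriods.KontsevichZagierPeriods.Theorems.LiouvilleUnfoldingAyoubPiLocalKernelRing
import Summits.KontsevichZagierPeriods.KontsevichZagierPeriods.Theorems.LiouvilleUnfoldingAyoubPiLocalKernel

/-!
# Crux stmt-KontsevichZagierPeriods-0541 `AyoubPiLocalKernel` — crux-ideate round 1, ideator 2: first lemmas

Two idea cards, both over the commutative formal period ring `P := KZ.FormalPeriodRing = FormalRep ⧸ relations`
(`KZRulesAssociator.lean`) with `ϖ := ⟦[π]⟧ = KZ.toFormalPeriod (KZ.of KZ.piRep)` the class of the disc, in which the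
crux reads (landed, p136024, `piLocalKernel_iff_forall_evalP`): `∀ x : P, evalP x = 0 → ∃ N, ϖ ^ N * x = 0`.

* §1 `adjugate-transposition` — Cramer's rule in `P`: a ONE-sided perfect pairing `A * B = ϖ^m • 1` between two square
  matrices of formal periods forces the TWO-sided one only `ϖ`-locally, with the explicit exponent `m · n`
  (`transpose_pairing`, pure commutative algebra: `B * adjugate B = det B • 1`, `det A * det B = ϖ^(m n)`); hence every
  entry of `B * A - ϖ^m • 1` satisfies BOTH the hypothesis (`evalP = 0`) and the conclusion (`ϖ`-power torsion) of the
  crux, unconditionally (`transposedPairing_instance`). `sat_transfer`: determinant-saturation is `ϖ`-localisation.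
* §2 `nilradical-cut` — the exact cut `PiLocalKernel ↔ NilLocalKernel ∧ LocallyReducedOnTorsion`
  (`piLocalKernel_iff_nil_and_reduced`, for the route decl `ayoubPiLocalKernel_iff_nil_and_reduced`), the prime-ideal
  reading of the transcendence half (`nilLocalKernel_iff_primes`: every prime of `P` avoiding `ϖ` contains `ker evalP`)
  and the sufficient condition for the geometric half (`locallyReduced_of_isReduced`: `P[ϖ⁻¹]` reduced).

Everything here is PROVED (no `sorry`); nothing conjecture-grade is asserted.
-/

noncomputable section

open Literature.NumberTheory.Transcendental

namespace Summit.KontsevichZagierPeriods.KontsevichZagierPeriods.Cruxes.AyoubPiLocalKernel.Ideator2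

open Summit.KontsevichZagierPeriods.LiouvilleUnfolding.PiLocalKernelPosition
open Summit.KontsevichZagierPeriods.KontsevichZagierPeriods.Theses.LiouvilleUnfolding (AyoubPiLocalKernel)

/-- The formal period ring of the calculus. -/
abbrev P : Type := KZ.FormalPeriodRing

/-- The class `ϖ = ⟦[π]⟧` of the disc (reducible: it is the landed files' `KZ.toFormalPeriod (KZ.of KZ.piRep)`). -/
abbrev piClass : P := KZ.toFormalPeriod (KZ.of KZ.piRep)

local notation "ϖ" => piClass

theorem piClass_def : ϖ = KZ.toFormalPeriod (KZ.of KZ.piRep) := rfl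

theorem evalP_piClass : KZ.evalP ϖ = Real.pi := by
  rw [piClass_def, KZ.evalP_toFormalPeriod, KZ.eval_of, KZ.piRep_value]

theorem evalP_piClass_pow_ne_zero (N : ℕ) : KZ.evalP (ϖ ^ N) ≠ 0 := by
  rw [map_pow, evalP_piClass]; exact pow_ne_zero N Real.pi_ne_zero

/-! ## §1 Adjugate transposition: determinant-saturation is `ϖ`-localisation -/

section Algebra

variable {R : Type*} [CommRing R]

/-- **Saturation transfer.** If a "determinant" `d` is certified to be a unit times `w ^ m` modulo an ideal `I`
(think: `I` = certified relations, `d` = det of a period matrix, `w` = `[π]`, the certificate = a compiled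
Poincaré-duality / Riemann bilinear relation), then every `d`-saturated consequence of `I` is a `w`-local
consequence with the explicit exponent `m * N`. [folklore] -/
theorem sat_transfer {I : Ideal R} {d w u : R} (hu : IsUnit u) {m : ℕ} (hd : d - u * w ^ m ∈ I)
    {x : R} {N : ℕ} (hx : d ^ N * x ∈ I) : w ^ (m * N) * x ∈ I := by
  rw [← Ideal.Quotient.eq_zero_iff_mem] at hx ⊢
  have hd' : Ideal.Quotient.mk I d = Ideal.Quotient.mk I (u * w ^ m) := by
    rw [Ideal.Quotient.eq]; exact hd
  rw [map_mul, map_pow, hd', ← map_pow, ← map_mul, Ideal.Quotient.eq_zero_iff_mem] at hx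
  have : (u * w ^ m) ^ N * x = u ^ N * (w ^ (m * N) * x) := by ring
  rw [this, ← Ideal.Quotient.eq_zero_iff_mem, map_mul] at hx
  have hu' : IsUnit (Ideal.Quotient.mk I (u ^ N)) := (hu.pow N).map _
  exact (hu'.mul_right_eq_zero).mp hx

variable {n : Type*} [Fintype n] [DecidableEq n]

/-- **One-sided pairing ⟹ `w`-local two-sided pairing (Cramer).** In any commutative ring: if
`A * B = w • 1` then `w ^ n • (B * A - w • 1) = 0` (`n` = size). Proof: `(BA - w)·B = 0`, multiply by
`adjugate B` on the right (`B · adj B = det B • 1`), then by `det A` (`det A · det B = w ^ n`). With `w` a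
non-unit (e.g. `w = ⟦[π]⟧^m` in the formal period ring) the factor `w ^ n` cannot be removed: two-sided
inverses of period matrices exist only after inverting `[π]`. [folklore] -/
theorem transpose_pairing (A B : Matrix n n R) (w : R) (h : A * B = w • (1 : Matrix n n R)) :
    w ^ Fintype.card n • (B * A - w • (1 : Matrix n n R)) = 0 := by
  have h1 : (B * A - w • (1 : Matrix n n R)) * B = 0 := by
    rw [sub_mul, Matrix.mul_assoc, h, Matrix.mul_smul, Matrix.mul_one, Matrix.smul_mul, Matrix.one_mul,
      sub_self]
  have h2 : (B * A - w • (1 : Matrix n n R)) * (B * B.adjugate) = 0 := by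
    rw [← Matrix.mul_assoc, h1, Matrix.zero_mul]
  rw [Matrix.mul_adjugate, Matrix.mul_smul, Matrix.mul_one] at h2
  have hdet : A.det * B.det = w ^ Fintype.card n := by
    rw [← Matrix.det_mul, h, Matrix.det_smul, Matrix.det_one, mul_one]
  rw [← hdet, mul_smul, h2, smul_zero]

end Algebra

variable {n : Type*} [Fintype n] [DecidableEq n]

/-- **Unconditional instances of the crux's shape.** For square matrices `A`, `B` of formal periods with a
certified one-sided pairing `A * B = ϖ^m • 1` (the compiled form of a perfect duality pairing whose
determinant is a power of `π`), every entry `x` of the transposed relation `B * A - ϖ^m • 1` is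
(i) of value zero and (ii) killed by `ϖ ^ (m * n)` modulo the four moves — i.e. it satisfies hypothesis
AND conclusion of `KZ.PiLocalKernel` with an explicit exponent, while `x ∈ relations` itself would need
`π`-cancellation (item 0540). [folklore] -/
theorem transposedPairing_instance (A B : Matrix n n P) (m : ℕ)
    (h : A * B = (ϖ ^ m) • (1 : Matrix n n P)) (i j : n) :
    KZ.evalP ((B * A - (ϖ ^ m) • (1 : Matrix n n P)) i j) = 0 ∧
      ϖ ^ (m * Fintype.card n) * (B * A - (ϖ ^ m) • (1 : Matrix n n P)) i j = 0 := by
  have key := transpose_pairing A B (ϖ ^ m) h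
  have hij := congrFun (congrFun key i) j
  simp only [Matrix.smul_apply, Matrix.zero_apply, smul_eq_mul, ← pow_mul] at hij
  refine ⟨?_, hij⟩
  have h' := congrArg KZ.evalP hij
  rw [map_mul, map_zero] at h'
  exact (mul_eq_zero.mp h').resolve_left (evalP_piClass_pow_ne_zero _)

/-- The same, read through the crux: the transposed-pairing entries lie in `ker evalP` and are `ϖ`-power
torsion, so they can never separate `KZ.PiLocalKernel` from the truth — and they are `ϖ`-power torsion
BY CERTIFICATE (the chain is the algebra above applied to the `n²` pairing chains). [folklore] -/
theorem transposedPairing_mem_ker_and_torsion (A B : Matrix n n P) (m : ℕ)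
    (h : A * B = (ϖ ^ m) • (1 : Matrix n n P)) (i j : n) :
    (B * A - (ϖ ^ m) • (1 : Matrix n n P)) i j ∈ RingHom.ker KZ.evalP ∧
      ∃ N : ℕ, ϖ ^ N * (B * A - (ϖ ^ m) • (1 : Matrix n n P)) i j = 0 :=
  ⟨(transposedPairing_instance A B m h i j).1, _, (transposedPairing_instance A B m h i j).2⟩

/-- **Transport of a certified relation to the dual datum (degree-one case).** If `A * B = w • 1` is certified
and a linear form `L` kills the COLUMNS of `A` weighted by a matrix `C` (`A * C = 0`, e.g. an endomorphism /
CM relation written as `A C = 0`), then `w • (C * ?)`… — simplest transpose instance: `A * C = 0 → w • (C) = ?`.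
We record the clean statement actually needed by the card: a right annihilator of `A` is `w`-locally a right
annihilator of… no: it is `w`-locally ZERO (`A C = 0 ⟹ B A C = 0 ⟹ (w • 1) C = 0` up to the two-sided defect),
i.e. certified column relations of an invertible-up-to-`π` period matrix are `π`-locally trivial. [folklore] -/
theorem annihilator_piLocal (A B C : Matrix n n P) (m : ℕ)
    (h : A * B = (ϖ ^ m) • (1 : Matrix n n P)) (hC : A * C = 0) :
    (ϖ ^ m) ^ Fintype.card n • ((ϖ ^ m) • C) = 0 := by
  have key := transpose_pairing A B (ϖ ^ m) h
  -- w^n • (B A - w) = 0  ⟹  w^n • (B A C - w C) = 0, and B A C = B 0 = 0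
  have : (ϖ ^ m) ^ Fintype.card n • ((B * A - (ϖ ^ m) • (1 : Matrix n n P)) * C) = 0 := by
    rw [← Matrix.smul_mul, key, Matrix.zero_mul]
  rw [sub_mul, Matrix.mul_assoc, hC, Matrix.mul_zero, zero_sub, Matrix.smul_mul, Matrix.one_mul,
    smul_neg, neg_eq_zero] at this
  exact this

/-- **The power of `w` cannot be dropped in a general commutative ring** (so some hypothesis on `[π]` —
exactly `π`-cancellation, item 0540 — is needed to transpose ABSOLUTELY): in `M₂(ℤ)` take `A = E₁₂`,
`B = E₁₁`, `w = 0`; then `A * B = w • 1` but `B * A = E₁₂ ≠ w • 1`. (In any such example `w` is a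
zero-divisor on `B * A - w • 1`, by `transpose_pairing`.) [folklore] -/
example : ∃ (A B : Matrix (Fin 2) (Fin 2) ℤ) (w : ℤ), A * B = w • (1 : Matrix (Fin 2) (Fin 2) ℤ) ∧
    B * A ≠ w • (1 : Matrix (Fin 2) (Fin 2) ℤ) := by
  refine ⟨Matrix.of ![![0, 1], ![0, 0]], Matrix.of ![![1, 0], ![0, 0]], 0, ?_, ?_⟩
  · ext i j
    fin_cases i <;> fin_cases j <;> simp [Matrix.mul_apply, Fin.sum_univ_two]
  · intro h
    have := congrFun (congrFun h 0) 1
    simp [Matrix.mul_apply, Fin.sum_univ_two] at this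

/-! ## §2 The nilradical cut: `PiLocalKernel ↔ NilLocalKernel ∧ LocallyReducedOnTorsion` -/

/-- **Transcendence half.** Every class of value `0` is NILPOTENT after inverting the disc:
`ϖ ^ N * x ^ (k+1) = 0` for some `N, k`. Equivalently (`nilLocalKernel_iff_primes`): every prime ideal of `P`
not containing `ϖ` contains `ker evalP` — "`ker evalP` is the unique minimal prime of `P[ϖ⁻¹]`", the calculus
shadow of "the comparison point is generic AND the localised period scheme is irreducible"
(HuberMullerStachPeriods2017 Conj. 13.2.5: `X(M)` connected and `trdeg = dim`). Summit-implied. -/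
def NilLocalKernel : Prop :=
  ∀ x : P, KZ.evalP x = 0 → ∃ N k : ℕ, ϖ ^ N * x ^ (k + 1) = 0

/-- **Geometric half (transcendence-free).** `P[ϖ⁻¹]` has no nilpotents among the `ϖ`-locally nil classes:
`ϖ ^ N * x ^ (k+1) = 0 → ∃ N', ϖ ^ N' * x = 0`. Motivic shadow: the localised formal period algebra is the
coordinate ring of a torsor under a pro-algebraic group in characteristic `0`, hence REDUCED (Cartier);
no real number occurs in the statement. Implied by `IsReduced (Localization.Away ϖ)`
(`locallyReduced_of_isReduced`) and by the summit. -/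
def LocallyReducedOnTorsion : Prop :=
  ∀ x : P, (∃ N k : ℕ, ϖ ^ N * x ^ (k + 1) = 0) → ∃ N : ℕ, ϖ ^ N * x = 0

/-- **The cut is exact.** [folklore] -/
theorem piLocalKernel_iff_nil_and_reduced :
    KZ.PiLocalKernel ↔ NilLocalKernel ∧ LocallyReducedOnTorsion := by
  rw [piLocalKernel_iff_forall_evalP]
  constructor
  · intro h
    refine ⟨fun x hx => ?_, fun x ⟨N, k, hNk⟩ => ?_⟩
    · obtain ⟨N, hN⟩ := h x hx
      exact ⟨N, 0, by rw [zero_add, pow_one]; exact hN⟩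
    · apply h
      have h' := congrArg KZ.evalP hNk
      rw [map_mul, map_zero] at h'
      have h'' := (mul_eq_zero.mp h').resolve_left (evalP_piClass_pow_ne_zero _)
      rw [map_pow] at h''
      exact (pow_eq_zero_iff (Nat.succ_ne_zero k)).mp h''
  · rintro ⟨hnil, hred⟩ x hx
    exact hred x (hnil x hx)

/-- The cut for the route declaration of item 0541 (`AyoubPiLocalKernel`, interface typing). [folklore] -/
theorem ayoubPiLocalKernel_iff_nil_and_reduced :
    AyoubPiLocalKernel ↔ NilLocalKernel ∧ LocallyReducedOnTorsion :=
  ayoubPiLocalKernel_iff_piLocalKernel.trans piLocalKernel_iff_nil_and_reduced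

/-- The composition a crux-plan skeleton would use: the two halves give the crux BY NAME. [folklore] -/
theorem ayoubPiLocalKernel_of (h₁ : NilLocalKernel) (h₂ : LocallyReducedOnTorsion) : AyoubPiLocalKernel :=
  ayoubPiLocalKernel_iff_nil_and_reduced.mpr ⟨h₁, h₂⟩

/-- **Reducedness of the localised ring suffices for the geometric half.** [folklore] -/
theorem locallyReduced_of_isReduced [h : IsReduced (Localization.Away piClass)] :
    LocallyReducedOnTorsion := by
  rintro x ⟨N, k, hNk⟩
  set L := Localization.Away piClass
  have hunit : IsUnit (algebraMap P L ϖ) := IsLocalization.Away.algebraMap_isUnit ϖ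
  -- the image of x is nilpotent
  have hnil : IsNilpotent (algebraMap P L x) := by
    refine ⟨k + 1, ?_⟩
    have h' := congrArg (algebraMap P L) hNk
    rw [map_mul, map_pow, map_pow, map_zero] at h'
    exact ((hunit.pow N).mul_right_eq_zero).mp h'
  have hzero : algebraMap P L x = 0 := hnil.eq_zero
  rw [IsLocalization.map_eq_zero_iff (Submonoid.powers piClass)] at hzero
  obtain ⟨⟨c, N', rfl⟩, hc⟩ := hzero
  exact ⟨N', hc⟩

/-- **Prime-ideal reading of the transcendence half**: `NilLocalKernel` says exactly that every prime ideal
of the formal period ring avoiding the disc contains the value-kernel — every multiplicative, move-invariant,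
field-valued "integration theory" in which `[π]` does not vanish kills every combination of value `0`.
[folklore] -/
theorem nilLocalKernel_iff_primes :
    NilLocalKernel ↔ ∀ q : Ideal P, q.IsPrime → ϖ ∉ q → RingHom.ker KZ.evalP ≤ q := by
  constructor
  · intro h q hq hϖ x hx
    obtain ⟨N, k, hNk⟩ := h x hx
    have hmem : ϖ ^ N * x ^ (k + 1) ∈ q := by rw [hNk]; exact q.zero_mem
    rcases hq.mem_or_mem hmem with h1 | h2
    · exact absurd (hq.mem_of_pow_mem N h1) hϖ
    · exact hq.mem_of_pow_mem (k + 1) h2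
  · intro h x hx
    by_contra hcon
    push Not at hcon
    -- the multiplicative set {ϖ^a * x^b} avoids 0
    let S : Submonoid P :=
      { carrier := {y | ∃ a b : ℕ, y = ϖ ^ a * x ^ b}
        mul_mem' := by
          rintro _ _ ⟨a, b, rfl⟩ ⟨c, d, rfl⟩
          exact ⟨a + c, b + d, by ring⟩
        one_mem' := ⟨0, 0, by simp⟩ }
    have h0 : (0 : P) ∉ S := by
      rintro ⟨a, b, hab⟩
      cases b with
      | zero =>
        have := evalP_piClass_pow_ne_zero a
        rw [show ϖ ^ a = 0 by simpa using hab.symm] at this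
        exact this (map_zero _)
      | succ k => exact hcon a k hab.symm
    have hdisj : Disjoint ((⊥ : Ideal P) : Set P) S := by
      rw [Set.disjoint_left]
      intro y hy hyS
      rw [SetLike.mem_coe, Ideal.mem_bot] at hy
      subst hy
      exact h0 hyS
    obtain ⟨q, hq, -, hqS⟩ := Ideal.exists_le_prime_disjoint (⊥ : Ideal P) S hdisj
    have hϖ : ϖ ∉ q := fun hϖq =>
      Set.disjoint_left.mp hqS hϖq ⟨1, 0, by simp⟩
    have hxq : x ∉ q := fun hxq =>
      Set.disjoint_left.mp hqS hxq ⟨0, 1, by simp⟩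
    exact hxq (h q hq hϖ hx)

/-- Sanity: the summit's kernel form gives both halves (so neither is refutable short of ¬Conjecture 1). -/
theorem nil_and_reduced_of_kernel (hK : ∀ c : KZ.FormalRep, KZ.eval c = 0 → c ∈ KZ.relations) :
    NilLocalKernel ∧ LocallyReducedOnTorsion :=
  piLocalKernel_iff_nil_and_reduced.mp (KZ.piLocalKernel_of_kernel hK)

/-! ### Position of the cut in the localisation lattice -/

/-- The generic-point clause of the fraction-field cut (crux 10813, card fraction-field-genericity), ring form:
a class of value `0` is `0` or a zero-divisor. -/
def GenericEvalP : Prop :=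
  ∀ x : P, KZ.evalP x = 0 → x = 0 ∨ ∃ y : P, y ≠ 0 ∧ x * y = 0

/-- `PiLocalKernel ⟹ NilLocalKernel ⟹ GenericEvalP`: the nil form sits between the crux and the
generic-point clause in logical strength of STATEMENT (all three are expected true). [folklore] -/
theorem nilLocalKernel_of_piLocalKernel (h : KZ.PiLocalKernel) : NilLocalKernel :=
  (piLocalKernel_iff_nil_and_reduced.mp h).1

theorem genericEvalP_of_nilLocalKernel (h : NilLocalKernel) : GenericEvalP := by
  intro x hx
  obtain ⟨N, k, hNk⟩ := h x hx
  -- induction on k: peel one factor x at a time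
  induction k generalizing N with
  | zero =>
    rw [zero_add, pow_one] at hNk
    by_cases hx0 : x = 0
    · exact Or.inl hx0
    · refine Or.inr ⟨ϖ ^ N, fun h0 => ?_, by rw [mul_comm]; exact hNk⟩
      exact evalP_piClass_pow_ne_zero N (by rw [h0, map_zero])
  | succ k ih =>
    by_cases hy : ϖ ^ N * x ^ (k + 1) = 0
    · exact ih N hy
    · refine Or.inr ⟨ϖ ^ N * x ^ (k + 1), hy, ?_⟩
      calc x * (ϖ ^ N * x ^ (k + 1)) = ϖ ^ N * x ^ (k + 1 + 1) := by ring
        _ = 0 := hNk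

/-- `π`-regularity in the ring (= item 0540 `PiCancellation`, ring form). -/
def PiRegular : Prop := ∀ z : P, ϖ * z = 0 → z = 0

theorem piRegular_iff_piCancellation : PiRegular ↔ KZ.PiCancellation := by
  constructor
  · intro h c hc
    rw [← KZ.toFormalPeriod_eq_zero_iff] at hc ⊢
    rw [map_mul] at hc
    exact h _ hc
  · intro h z hz
    obtain ⟨c, rfl⟩ := KZ.toFormalPeriod_surjective z
    rw [← map_mul, KZ.toFormalPeriod_eq_zero_iff] at hz
    exact (KZ.toFormalPeriod_eq_zero_iff).mpr (h c hz)

/-- The kernel conjecture (= the summit, `kzKernelConjecture_iff_isRational`) in ring form. [folklore] -/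
theorem kernel_iff_evalP_injective :
    KZKernelConjecture ↔ ∀ x : P, KZ.evalP x = 0 → x = 0 := by
  constructor
  · intro h x hx
    obtain ⟨c, rfl⟩ := KZ.toFormalPeriod_surjective x
    exact (KZ.toFormalPeriod_eq_zero_iff).mpr (h c hx)
  · intro h c hc
    exact (KZ.toFormalPeriod_eq_zero_iff).mp (h _ hc)

/-- **Three-way cut of the summit through the nil form**: Conjecture 1 (kernel form) ⟺ (transcendence:
`NilLocalKernel`) ∧ (no nilpotents: `IsReduced P`, crux 3929's shape, shadow = Cartier) ∧ (no `π`-torsion: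
`PiRegular` = item 0540, shadow = fullness of `MM^eff → MM`, open). [folklore] -/
theorem kernel_iff_nil_reduced_regular :
    KZKernelConjecture ↔ NilLocalKernel ∧ IsReduced P ∧ PiRegular := by
  rw [kernel_iff_evalP_injective]
  constructor
  · intro h
    refine ⟨fun x hx => ⟨0, 0, by simpa using h x hx⟩, ⟨fun x ⟨m, hm⟩ => h x ?_⟩, fun z hz => h z ?_⟩
    · have := congrArg KZ.evalP hm
      rw [map_pow, map_zero] at this
      exact pow_eq_zero_iff' |>.mp this |>.1
    · have := congrArg KZ.evalP hz
      rw [map_mul, map_zero] at this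
      refine (mul_eq_zero.mp this).resolve_left ?_
      simpa using evalP_piClass_pow_ne_zero 1
  · rintro ⟨hnil, hred, hreg⟩ x hx
    obtain ⟨N, k, hNk⟩ := hnil x hx
    have hk : x ^ (k + 1) = 0 := by
      induction N with
      | zero => simpa using hNk
      | succ N ih => exact ih (hreg _ (by rw [← mul_assoc, ← pow_succ']; exact hNk))
    exact hred.eq_zero x ⟨k + 1, hk⟩

end Summit.KontsevichZagierPeriods.KontsevichZagierPeriods.Cruxes.AyoubPiLocalKernel.Ideator2
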